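import Summits.KontsevichZagierPeriods.Zeta5Search.Barrier.ConeGammaLemmaFWinCert

/-!
# ζ(5) search — BARRIER: the WINDOWED Lemma F bound with members on direction BOXES — hinge sums, the cut form,
# and the computable box checker

HONEST FRAMING (cell `pub-zeta5`): systematic search; no irrationality claim unless kernel-certified. Kernel ARITHMETIC
(outward-rounded fixed-point enclosures, the tree's `NumericsMP.MI` at scale `2^60`) about P2 g24's WINDOWED LEMMA F WITH
MEMBERS (`phi30_le_windows_members`, in cert-2 g35's names `LemmaFWin.winForm` / `phi30_aOfS_le_winForm`) as a function of
the direction on a seven-coordinate BOX `lo_i ≤ D·t_i ≤ hi_i` (`t₀ = 1`). Every such bound and `Φ = phi30` is a MODEL-side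
object under Brown–Zudilin's (28)+(30) ((28) observed, not proved); member / cut CHOICES are data of a certificate.
Nothing here is about C₀ / C₁ / δ₂₈ (so NO γ-statement anywhere), any γ of record, the cone's sup, C2 (OPEN), S-E
(CONJECTURED), (TD_A) or `ζ(5)`; no number of record moves; records in print UNMOVED. Theory seat cert-2 g36 (item
«WINDOWED LEMMA F ON BOXES — KERNEL», INBOX plan 2026-08-27), part 1: forms and checker; soundness is
`ConeGammaLemmaFWinBoxSound`, the box theorem `ConeGammaLemmaFWinBoxCert`, the certificates `ConeGammaLemmaFWinBoxes`.

THE ARITHMETIC FACT (desk-checked against P2's J-form at all 24 SET A / SET B data of g35 to ≤ 5·10⁻¹⁴; proved in the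
soundness file): with `Ψ(b) := H_⌊b⌋ − ⌊b⌋/b` (`H_n` the harmonic number) one has `δ(a,b) = Ψ(a) − Ψ(b)` (g35's `dG`), so
for `x ≥ 0`, `U > 0`: **`x·J(U,x) = jT x U = x log x + Ψ(U)·x − q_U(x)`** with the HINGE SUM
**`q_U(x) := x·H_⌊Ux⌋ − ⌊Ux⌋/U = Σ_{k≥1} (x/k − 1/U)₊`** — continuous, convex, piecewise linear, slope `H_N` on
`[N/U, (N+1)/U]`. Since every member's linear parts cancel (`Σ_m ε_m x_m ≡ 0`), the windowed bound takes the CUT FORM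
`B(t) = Σ_{w<W} c_w(1/U_w − 1/U_{w+1}) + c_W/U_W + Σ_{j≤W} [P_j − P_{j−1}](q_{U_j})(t) − P_W(x log x)(t)`
(`P_j` the signed feature pattern of window `j`'s member, `P_{−1} = 0`), and on a box the EXACT SECANT ENCLOSURES
`(q_U(y) − q_U(x))/(y − x) ∈ [H_⌊U·lo_f⌋, H_⌊U·hi_f⌋]`, `(y log y − x log x)/(y − x) ∈ [1 + log lo_f, 1 + log hi_f]` give
`B(t) − B(t_c) = Σ_i (t_i − t_{c,i})·v_i` with `v_i` in an explicit interval hull, hence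
`sup_box B ≤ B(t_c) + Σ_i r_i·max|hull_i|` — organised PER CUT with the merged integer coefficients `P_j − P_{j−1}`,
so a cut where the member does not change contributes nothing.

* Real side: `harmR`, `psiH`, `qH` (hinge sum), `entG F g t := Σ_{(c,f)∈F} c·g(x_f(t))` (g34's `entF F = entG F (x log x)`),
  `memConst` / `featRest` / `cutForm` (the bound along the cut / member lists: constant part + feature part).
* Computable side (integer / `MI` / Bool / List data only, none Prop-valued): `pairVec`, `wallVec`, `orientB`, `memTab`
  (the member's feature table with the orientation of the difference features DECIDED ON THE BOX, `none` if ambiguous),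
  `cntB`, `linOK`, `nonnegOK`, `tabList`, `insertTab` / `subTab` / `mergePrev` (merged tables), `harmEnc`, `qSlope` / `logSlope1`, `addHull`, `accQ` / `accLog`, `cutAcc`,
  `wallOKBox`, `boxOK8`, `wboxSummary`, **`wboxCheck`**.
-/

open Finset Set MeasureTheory
open Literature.Analysis.ValidatedNumerics.NumericsMP

namespace Summit.KontsevichZagierPeriods.Zeta5Search.Barrier.ConeGamma

namespace LemmaFWinBox

open LemmaFBox (SC KT lnNat coef featVal minNum maxNum sum8 box centre)
open LemmaFWin (jT dG memShape memT memC winForm zI winEnc Pz)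

/-! ### Real side -/

/-- The harmonic number `H_n = Σ_{k<n} 1/(k+1)` as a real number (`H_0 = 0`). -/
noncomputable def harmR (n : ℕ) : ℝ := ∑ k ∈ Finset.range n, (1 : ℝ) / ((k : ℝ) + 1)

/-- `Ψ(b) = H_⌊b⌋ − ⌊b⌋/b` — an antiderivative of `⌊w⌋ w⁻²` (continuous, piecewise smooth): `δ(a,b) = Ψ(a) − Ψ(b)`. -/
noncomputable def psiH (b : ℝ) : ℝ := harmR ⌊b⌋₊ - (⌊b⌋₊ : ℝ) / b

/-- **The hinge sum** `q_U(x) = x·H_⌊Ux⌋ − ⌊Ux⌋/U` (`= Σ_{k≥1} (x/k − 1/U)₊ = x·Ψ(Ux)`): continuous, convex and piecewise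
linear in `x`, with slope `H_N` on `[N/U, (N+1)/U]`. -/
noncomputable def qH (U x : ℝ) : ℝ := x * harmR ⌊U * x⌋₊ - (⌊U * x⌋₊ : ℝ) / U

/-- `x log x`. -/
noncomputable def mulLog (x : ℝ) : ℝ := x * Real.log x

/-- A feature table applied to a function of the feature value: `entG F g t = Σ_{(c,f)∈F} c·g(x_f(t))`
(g34's entropy form is `entF F = entG F mulLog`). -/
noncomputable def entG : List (ℤ × List ℤ) → (ℝ → ℝ) → (Fin 8 → ℝ) → ℝ
  | [], _, _ => 0
  | f :: F, g, t => (f.1 : ℝ) * g (featVal f.2 t) + entG F g t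

/-- The member-dependent CONSTANT part of the windowed bound, by recursion over (cuts, flip counts):
`Σ_{w<W} c_w(1/U_w − 1/U_{w+1}) + c_W/U_W` (`U_w = A_w/E`). -/
noncomputable def memConst (E : ℕ) : List ℕ → List ℕ → ℝ
  | [A], [c] => (c : ℝ) / ((A : ℝ) / E)
  | A :: A' :: As, c :: cs => (c : ℝ) * (1 / ((A : ℝ) / E) - 1 / ((A' : ℝ) / E)) + memConst E (A' :: As) cs
  | _, _ => 0

/-- The feature part of the windowed bound in WINDOW form, by recursion over (cuts, tables):
`Σ_{w<W} [E_w(q_{U_w}) − E_w(q_{U_{w+1}})] + E_W(q_{U_W}) − E_W(x log x)`, `E_w(g) = entG F_w g`. -/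
noncomputable def featRest (E : ℕ) : List ℕ → List (List (ℤ × List ℤ)) → (Fin 8 → ℝ) → ℝ
  | [A], [F], t => entG F (qH ((A : ℝ) / E)) t - entG F mulLog t
  | A :: A' :: As, F :: Fs, t =>
    (entG F (qH ((A : ℝ) / E)) t - entG F (qH ((A' : ℝ) / E)) t) + featRest E (A' :: As) Fs t
  | _, _, _ => 0

/-- **The cut form** of the windowed bound along the lists: constant part + feature part. -/
noncomputable def cutForm (E : ℕ) (cuts : List ℕ) (cs : List ℕ) (Ts : List (List (ℤ × List ℤ))) (t : Fin 8 → ℝ) : ℝ :=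
  memConst E cuts cs + featRest E cuts Ts t

/-! ### Computable side: feature vectors and member tables on a box -/

/-- The coefficient vector (length 8, on `(t₀,…,t₇)`) of the pair feature `t_i + t_j` (`neg = false`) /
`t_i − t_j` (`neg = true`). -/
def pairVec (i j : ℕ) (neg : Bool) : List ℤ :=
  (List.range 8).map fun k => (if k = i then (1 : ℤ) else 0) + (if k = j then (if neg then -1 else 1) else 0)

/-- The 28 forms of `h28_aOfS` as coefficient vectors (order of `LemmaFWin.wallForm`). -/
def wallVec (k : Fin 28) : List ℤ :=
  pairVec (LemmaFWin.wallForm k).1.1 (LemmaFWin.wallForm k).2.1.1 (LemmaFWin.wallForm k).2.2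

/-- Orientation of the difference feature of member index `v` against `i` ON THE BOX: `some true` if `t_{i+1} ≤ t_{v+1}`
at every point of the box (`hi_{i+1} ≤ lo_{v+1}`), `some false` if `t_{i+1} > t_{v+1}` everywhere (`hi_{v+1} < lo_{i+1}`),
`none` if undecided. -/
def orientB (lo hi : List ℕ) (i v : Fin 7) : Option Bool :=
  if hi.getD (i.1 + 1) 0 ≤ lo.getD (v.1 + 1) 0 then some true
  else if hi.getD (v.1 + 1) 0 < lo.getD (i.1 + 1) 0 then some false
  else none

/-- The reoriented difference entries of member `(v,w)` over a list of indices (`v`, `w` skipped), or `none`. -/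
def diffTab (lo hi : List ℕ) (v w : Fin 7) : List (Fin 7) → Option (List (ℤ × List ℤ))
  | [] => some []
  | i :: is =>
    match diffTab lo hi v w is with
    | none => none
    | some T =>
      if i = v ∨ i = w then some T
      else
        match orientB lo hi i v with
        | none => none
        | some true => some ((1, pairVec (v.1 + 1) (i.1 + 1) true) :: T)
        | some false => some ((-1, pairVec (i.1 + 1) (v.1 + 1) true) :: T)

/-- The number of flipped orientations over a list of indices. -/
def cntD (lo hi : List ℕ) (v w : Fin 7) : List (Fin 7) → ℕ
  | [] => 0
  | i :: is => (if i = v ∨ i = w then 0 else if orientB lo hi i v = some false then 1 else 0) + cntD lo hi v w is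

/-- The flip count `c = 1 + #{i ∉ {v,w} : t_{i+1} > t_{v+1}}` ON THE BOX. -/
def cntB (lo hi : List ℕ) (v w : Fin 7) : ℕ := 1 + cntD lo hi v w (List.finRange 7)

/-- The `−(t_{v+1} + t_{j+1})` entries, `j ∉ {v,w}`, over a list of indices. -/
def sumTab (v w : Fin 7) : List (Fin 7) → List (ℤ × List ℤ)
  | [] => []
  | j :: js => if j = v ∨ j = w then sumTab v w js else (-1, pairVec (v.1 + 1) (j.1 + 1) false) :: sumTab v w js

/-- The six reference-path features and the two fixed `−(t₀ − t₂)`, `−(t₀ − t₃)`. -/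
def fixedTab : List (ℤ × List ℤ) :=
  [(1, pairVec 3 5 false), (1, pairVec 4 6 false), (1, pairVec 1 6 false), (1, pairVec 1 7 false),
   (1, pairVec 4 5 false), (1, pairVec 2 7 false), (-1, pairVec 0 2 true), (-1, pairVec 0 3 true)]

/-- **The feature table of member `(v,w)` ON THE BOX**: the signed 25-term pattern of `LemmaFWin.memShape` as
`(coefficient, feature vector)` pairs, the orientation of the difference features decided from the box (`none` if some
orientation is undecided on the box). -/
def memTab (lo hi : List ℕ) (v w : Fin 7) : Option (List (ℤ × List ℤ)) :=
  match diffTab lo hi v w (List.finRange 7) with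
  | none => none
  | some T =>
    some ([(1, pairVec 0 (v.1 + 1) false), (1, pairVec 0 (v.1 + 1) true), (-2, pairVec (v.1 + 1) (w.1 + 1) false)]
      ++ T ++ (sumTab v w (List.finRange 7) ++ fixedTab))

/-- The linear parts of a table cancel: `Σ_{(c,f)∈F} c·f_i = 0` for every coordinate `i < 8`. -/
def linOK (F : List (ℤ × List ℤ)) : Bool :=
  (List.range 8).all fun i => decide ((F.map fun f => f.1 * coef f.2 i).sum = 0)

/-- Every feature of the table is non-negative on the box (`0 ≤ minNum`); with `strict`, every feature with a non-zero
coefficient is positive on the box (`0 < minNum`). -/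
def nonnegOK (lo hi : List ℕ) (F : List (ℤ × List ℤ)) (strict : Bool) : Bool :=
  F.all fun f => decide (0 ≤ minNum f.2 lo hi) && (!strict || decide (f.1 = 0) || decide (0 < minNum f.2 lo hi))

/-- The member table with its checks: orientations decided, linear parts cancel, features non-negative on the box. -/
def memTabOK (lo hi : List ℕ) (vw : Fin 7 × Fin 7) : Option (List (ℤ × List ℤ)) :=
  match memTab lo hi vw.1 vw.2 with
  | none => none
  | some T => if linOK T && nonnegOK lo hi T false then some T else none

/-- The checked tables of all members, in order (`none` if one fails). -/
def tabList (lo hi : List ℕ) : List (Fin 7 × Fin 7) → Option (List (List (ℤ × List ℤ)))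
  | [] => some []
  | vw :: vws =>
    match memTabOK lo hi vw, tabList lo hi vws with
    | some T, some Ts => some (T :: Ts)
    | _, _ => none

/-- The flip counts of the members on the box, in order. -/
def cntList (lo hi : List ℕ) (mems : List (Fin 7 × Fin 7)) : List ℕ := mems.map fun vw => cntB lo hi vw.1 vw.2

/-- Insert an entry into a table, ADDING coefficients when the feature vector is already present. -/
def insertTab (e : ℤ × List ℤ) : List (ℤ × List ℤ) → List (ℤ × List ℤ)
  | [] => [e]
  | f :: F => if f.2 = e.2 then (f.1 + e.1, f.2) :: F else f :: insertTab e F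

/-- The merged table `A − B` (coefficients of equal feature vectors combined). -/
def subTab (A B : List (ℤ × List ℤ)) : List (ℤ × List ℤ) :=
  A.foldr insertTab (B.map fun f => (-f.1, f.2))

/-- The merged table at a cut: `P_j − P_{j−1}`, with `P_{−1} = 0`. -/
def mergePrev (T : List (ℤ × List ℤ)) : Option (List (ℤ × List ℤ)) → List (ℤ × List ℤ)
  | none => T
  | some P => subTab T P

/-! ### Computable side: slope enclosures and the per-cut accumulator -/

/-- `H_n` at scale `SC`, outward rounded. -/
def harmEnc : ℕ → MI
  | 0 => zI
  | n + 1 => (harmEnc n).add (MI.ofFrac SC 1 (n + 1))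

/-- Secant-slope enclosure of the hinge sum `q_{A/E}` for a feature ranging over `[minNum, maxNum]/D` on the box:
`[H_⌊A·minNum/(E·D)⌋, H_⌊A·maxNum/(E·D)⌋]` (meaningful for `minNum ≥ 0`). -/
def qSlope (D E A : ℕ) (lo hi : List ℕ) (f : List ℤ) : MI :=
  ⟨(harmEnc (A * (minNum f lo hi).toNat / (E * D))).lo, (harmEnc (A * (maxNum f lo hi).toNat / (E * D))).hi⟩

/-- Secant-slope enclosure of `x log x` for a feature ranging over `[minNum, maxNum]/D`, `minNum > 0`:
`[log minNum − log D + 1, log maxNum − log D + 1]` (`none` if a logarithm is unavailable). -/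
def logSlope1 (LD : MI) (lo hi : List ℕ) (f : List ℤ) : Option MI :=
  match lnNat (minNum f lo hi).toNat, lnNat (maxNum f lo hi).toNat with
  | some LA, some LB => some (((⟨LA.lo, LB.hi⟩ : MI).sub LD).add (MI.ofInt SC 1))
  | _, _ => none

/-- Hull entry `i` (the zero interval beyond the list). -/
def getI (g : List MI) (i : ℕ) : MI := g.getD i zI

/-- Add `I·(k·c_{f,i})` to hull entry `i` for all `i < 8`. -/
def addHull (g : List MI) (I : MI) (k : ℤ) (f : List ℤ) : List MI :=
  (List.range 8).map fun i => (getI g i).add (I.mulInt (k * coef f i))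

/-- Accumulate the hinge-slope terms of a (merged) table at cut `A/E`. -/
def accQ (D E A : ℕ) (lo hi : List ℕ) : List (ℤ × List ℤ) → List MI → List MI
  | [], g => g
  | f :: F, g => accQ D E A lo hi F (addHull g (qSlope D E A lo hi f.2) f.1 f.2)

/-- Accumulate the `x log x`-slope terms of the tail table (coefficient `−c`; zero-coefficient entries skipped). -/
def accLog (LD : MI) (lo hi : List ℕ) : List (ℤ × List ℤ) → List MI → Option (List MI)
  | [], g => some g
  | f :: F, g =>
    if f.1 = 0 then accLog LD lo hi F g
    else
      match logSlope1 LD lo hi f.2 with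
      | none => none
      | some I => accLog LD lo hi F (addHull g I (-f.1) f.2)

/-- **The per-cut accumulator**: walks the cuts `A_0, …, A_W` with the member tables; at cut `j` adds the hinge slopes of
the MERGED table `P_j − P_{j−1}` (`P_{−1} = 0`), and at the last cut also the `x log x` slopes of `P_W` (tail features with
non-zero coefficient must be positive on the box). `prev` = the previous member's table. -/
def cutAcc (D E : ℕ) (LD : MI) (lo hi : List ℕ) :
    List ℕ → List (List (ℤ × List ℤ)) → Option (List (ℤ × List ℤ)) → List MI → Option (List MI)
  | [A], [T], prev, g =>
    if nonnegOK lo hi T true then accLog LD lo hi T (accQ D E A lo hi (mergePrev T prev) g) else none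
  | A :: A' :: As, T :: Ts, prev, g => cutAcc D E LD lo hi (A' :: As) Ts (some T) (accQ D E A lo hi (mergePrev T prev) g)
  | _, _, _, _ => none

/-- First-wall condition ON THE BOX: `A₀ · maxNum(h_k) ≤ E · D` for all 28 forms. -/
def wallOKBox (lo hi : List ℕ) (E A0 D : ℕ) : Bool :=
  (List.finRange 28).all fun k => decide ((A0 : ℤ) * maxNum (wallVec k) lo hi ≤ ((E * D : ℕ) : ℤ))

/-- Well-formed direction box: `D > 0`, `lo₀ = hi₀ = D` (`t₀ = 1`), `lo_i ≤ hi_i ≤ D` for `i < 8`. -/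
def boxOK8 (D : ℕ) (lo hi : List ℕ) : Bool :=
  decide (0 < D) && decide (lo.getD 0 0 = D) && decide (hi.getD 0 0 = D) &&
    (List.range 8).all fun i => decide (lo.getD i 0 ≤ hi.getD i 0) && decide (hi.getD i 0 ≤ D)

/-- The centre numerators `lo_i + hi_i` (over `2D`). -/
def centrePt (lo hi : List ℕ) : List ℕ := (List.range 8).map fun i => lo.getD i 0 + hi.getD i 0

/-- The zero hull. -/
def zeroHull : List MI := (List.range 8).map fun _ => zI

/-- **The box summary**: the centre enclosure `I` of `winForm` (g35's `winEnc` at `(lo+hi)/(2D)`, VERBATIM) and the scaled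
slack `R = Σ_i (hi_i − lo_i)·M_i` (so that `sup_box winForm ≤ (I.hi + R/(2D))/SC`). -/
def wboxSummary (lo hi : List ℕ) (D E : ℕ) (cuts : List ℕ) (mems : List (Fin 7 × Fin 7)) : Option (MI × ℤ) :=
  match winEnc (centrePt lo hi) (2 * D) E cuts mems, lnNat D, tabList lo hi mems with
  | some I, some LD, some Ts =>
    match cutAcc D E LD lo hi cuts Ts none zeroHull with
    | none => none
    | some g =>
      some (I, sum8 fun i => (((hi.getD i 0 : ℕ) : ℤ) - ((lo.getD i 0 : ℕ) : ℤ)) * max |(getI g i).lo| |(getI g i).hi|)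
  | _, _, _ => none

/-- **Box check**: `winForm(t) ≤ p/q` for every direction `t` of the box `lo_i ≤ D·t_i ≤ hi_i` with the cuts `cuts/E` and
the members `mems`. -/
def wboxCheck (lo hi : List ℕ) (D E : ℕ) (cuts : List ℕ) (mems : List (Fin 7 × Fin 7)) (p : ℤ) (q : ℕ) : Bool :=
  boxOK8 D lo hi && decide (0 < q) && LemmaFWin.cutsOK E cuts mems && wallOKBox lo hi E (cuts.getD 0 0) D &&
    match wboxSummary lo hi D E cuts mems with
    | some (I, R) => decide ((I.hi * (2 * (D : ℤ)) + R) * (q : ℤ) ≤ p * (2 * (D : ℤ)) * (SC : ℤ))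
    | none => false

/-! ### Tables with coinciding feature vectors combined (the `N` variants used by the soundness theorems)

A member's 21-entry pattern can contain the SAME feature vector twice (e.g. `−(t_{v+1} + t_{j+1})` against one of the six
reference-path sums, or `t₀ − t_{v+1}` against `−(t₀ − t₂)`): if such duplicates are left in place, the merged table of two
EQUAL members is not literally empty and every cut would contribute slack. The variants below combine duplicates first
(`normTab`; same value of `entG`); `memTabOK` / `tabList` / `wboxSummary` / `wboxCheck` above are superseded by them (kept
unchanged under the append-only protocol) — the soundness theorems of `ConeGammaLemmaFWinBoxCert` are about `wboxCheckN`. -/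

/-- One hinge `(x/(k+1) − 1/U)₊` of the hinge sum (real side, for the soundness files). -/
noncomputable def hinge (U x : ℝ) (k : ℕ) : ℝ := max (x / ((k : ℝ) + 1) - 1 / U) 0

/-- The feature part from a cut onwards, given the previous member's table (`P_{−1} = 0`):
`featRest − P_prev(q_{U_first})` (real side, for the soundness files). -/
noncomputable def featRestP (E : ℕ) (prev : Option (List (ℤ × List ℤ))) (cuts : List ℕ)
    (Ts : List (List (ℤ × List ℤ))) (t : Fin 8 → ℝ) : ℝ :=
  featRest E cuts Ts t - (match prev with
    | none => 0
    | some P => entG P (qH (((cuts.getD 0 0 : ℕ) : ℝ) / E)) t)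

/-- A table with its duplicate feature vectors combined (same value of `entG`). -/
def normTab (T : List (ℤ × List ℤ)) : List (ℤ × List ℤ) := T.foldr insertTab []

/-- The member table, duplicates combined, with its checks: orientations decided, linear parts cancel, features
non-negative on the box. -/
def memTabOKN (lo hi : List ℕ) (vw : Fin 7 × Fin 7) : Option (List (ℤ × List ℤ)) :=
  match memTab lo hi vw.1 vw.2 with
  | none => none
  | some T => if linOK (normTab T) && nonnegOK lo hi (normTab T) false then some (normTab T) else none

/-- The checked, duplicate-free tables of all members, in order (`none` if one fails). -/
def tabListN (lo hi : List ℕ) : List (Fin 7 × Fin 7) → Option (List (List (ℤ × List ℤ)))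
  | [] => some []
  | vw :: vws =>
    match memTabOKN lo hi vw, tabListN lo hi vws with
    | some T, some Ts => some (T :: Ts)
    | _, _ => none

/-- **The box summary** (duplicate-free tables): the centre enclosure `I` of `winForm` (g35's `winEnc` at `(lo+hi)/(2D)`,
VERBATIM) and the scaled slack `R = Σ_i (hi_i − lo_i)·M_i` (so that `sup_box winForm ≤ (I.hi + R/(2D))/SC`). -/
def wboxSummaryN (lo hi : List ℕ) (D E : ℕ) (cuts : List ℕ) (mems : List (Fin 7 × Fin 7)) : Option (MI × ℤ) :=
  match winEnc (centrePt lo hi) (2 * D) E cuts mems, lnNat D, tabListN lo hi mems with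
  | some I, some LD, some Ts =>
    match cutAcc D E LD lo hi cuts Ts none zeroHull with
    | none => none
    | some g =>
      some (I, sum8 fun i => (((hi.getD i 0 : ℕ) : ℤ) - ((lo.getD i 0 : ℕ) : ℤ)) * max |(getI g i).lo| |(getI g i).hi|)
  | _, _, _ => none

/-- **Box check** (duplicate-free tables; the one used by the certificates): `winForm(t) ≤ p/q` for every direction `t` of
the box `lo_i ≤ D·t_i ≤ hi_i` with the cuts `cuts/E` and the members `mems`. -/
def wboxCheckN (lo hi : List ℕ) (D E : ℕ) (cuts : List ℕ) (mems : List (Fin 7 × Fin 7)) (p : ℤ) (q : ℕ) : Bool :=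
  boxOK8 D lo hi && decide (0 < q) && LemmaFWin.cutsOK E cuts mems && wallOKBox lo hi E (cuts.getD 0 0) D &&
    match wboxSummaryN lo hi D E cuts mems with
    | some (I, R) => decide ((I.hi * (2 * (D : ℤ)) + R) * (q : ℤ) ≤ p * (2 * (D : ℤ)) * (SC : ℤ))
    | none => false

end LemmaFWinBox

end Summit.KontsevichZagierPeriods.Zeta5Search.Barrier.ConeGamma
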